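import Literature.NumberTheory.Automorphic.HarishChandraGrowthGL
import Literature.NumberTheory.Automorphic.SmoothedAutomorphicForms
import HarnessLib

/-!
# The `L²` side of Borel–Jacquet 4.6 for `GL_n` from Harish-Chandra's convolution identity:
Lie derivatives of the automorphic forms of `Π` represent vectors of `Π`

Topic `NumberTheory/Automorphic`. Let `Π` be a closed `GL_n(𝔸_K)`-invariant subspace of
`L²(GL_n(𝔸_K) ⧸ A_G GL_n(K), μ)`, `f ∈ ℒ²(μ)` with `[f] ∈ Π` and `φ = invQuot f = (g ↦ f [g⁻¹])` an
automorphic form, and `X ∈ 𝔤𝔩_n(K_∞)`. Granted Harish-Chandra's convolution identity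
(`AutomorphicRepsGL.exists_convolution_eq_self`, `HarishChandraConvolutionGL`), one has
`X φ = φ ∗ α_X` with `α_X ∈ C_c(GL_n(K_∞))` (`exists_weight_lieDeriv_eq_integral`,
`HarishChandraGrowthGL`). Hence the vector `v_X = ∫ α_X(x) Π(x, 1) [f] dx` — a Bochner integral of
vectors of the closed subspace `Π`, so `v_X ∈ Π` — is represented by the orbital smoothing
`x₀ ↦ ∫ α_X(x) f((x, 1)⁻¹ • x₀) dx` (`coeFn_integral_smul_domSMul_ae_eq`, tree), whose value at
`[g]` is `∫ α_X(x) φ(g⁻¹ x) dx = (X φ)(g⁻¹)`; i.e. `X φ = invQuot f_X` with `[f_X] = v_X ∈ Π`. This is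
Borel 1972, Cor. 3.20–3.21 (a `K`-finite `Z(𝔤)`-finite vector is differentiable, with derivative
`π(X α̌) v`) in the form consumed by Step 2 of Borel–Jacquet 4.6:

* `orbitalSmoothing_ae_eq_of_ae_eq` — orbital smoothing respects a.e. equality (a.e.);
* the action of `GL_n(K_∞)` on the automorphic quotient through `GLn.ofInfinite` (local instances)
  and `domSMul_ofInfinite_eq_rightRegular`;
* `exists_toLp_mem_invQuot_eq_lieDeriv_of_convolution` — the statement of the named fact
  `AutomorphicRepsGL.exists_toLp_mem_invQuot_eq_lieDeriv hcpt μ` of `AutomorphicRepsGLCuspidalL2Step2`,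
  from the convolution identity.

Everything here is proved (the convolution identity enters as a hypothesis).

## References

* A. Borel, *Représentations de groupes localement compacts*, LNM 276 (1972), 3.8, Cor. 3.20–3.21
  [Borel1972].
* A. Borel, H. Jacquet, *Automorphic forms and automorphic representations*, Proc. Sympos. Pure
  Math. 33 (1979), part 1, 4.6 [BorelJacquet1979].
-/

noncomputable section

open scoped MatrixGroups Matrix ContDiff Topology Classical NNReal
open Filter MeasureTheory NumberField NumberField.mixedEmbedding IsDedekindDomain

namespace Literature.NumberTheory.Automorphic

/-! ### Orbital smoothing respects a.e. equality -/

section Smoothing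

variable {G X : Type*} [Group G] [MeasurableSpace G] [MeasurableInv G]
  [MulAction G X] [MeasurableSpace X] [MeasurableSMul₂ G X]
  {𝕜 : Type*} [RCLike 𝕜] {E' : Type*} [NormedAddCommGroup E'] [NormedSpace 𝕜 E'] [NormedSpace ℝ E']
  (μ : Measure X) (ν : Measure G) [SFinite μ] [SFinite ν] [SMulInvariantMeasure G X μ]

/-- **Orbital smoothing respects almost-everywhere equality**: if `f = f'` `μ`-a.e. then
`S_η f = S_η f'` `μ`-a.e. (for `μ`-a.e. `x`, `f(g⁻¹ • x) = f'(g⁻¹ • x)` for `ν`-a.e. `g`, because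
`(x, g) ↦ g⁻¹ • x` is quasi-measure-preserving from `μ ⊗ ν` to `μ`). [folklore] -/
theorem orbitalSmoothing_ae_eq_of_ae_eq (η : G → 𝕜) {f f' : X → E'} (h : f =ᵐ[μ] f') :
    orbitalSmoothing ν η f =ᵐ[μ] orbitalSmoothing ν η f' := by
  have hq := quasiMeasurePreserving_inv_smul_prod (μ := μ) (ν := ν)
  have h' : ∀ᵐ p ∂(μ.prod ν), f (p.2⁻¹ • p.1) = f' (p.2⁻¹ • p.1) := hq.ae_eq h
  filter_upwards [Measure.ae_ae_of_ae_prod h'] with x hx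
  unfold orbitalSmoothing
  refine integral_congr_ae ?_
  filter_upwards [hx] with g hg
  rw [hg]

end Smoothing

/-! ### The archimedean group acting on the automorphic quotient -/

section Action

variable (n : ℕ) (K : Type) [Field K] [NumberField K]

/-- The embedding `x ↦ (x, 1)`, `GL_n(K_∞) →* GL_n(𝔸_K)` (`GLn.ofInfinite`), with codomain typed
as the adelic group `(AdelicGroupData.gl n K).Adelic` of the datum (definitionally `GLn.ofInfinite`;
the retyping lets the action and representation instances of the datum apply). [folklore] -/
@[reducible] def GLn.ofInfiniteAdelic : GL (Fin n) (mixedSpace K) →* (AdelicGroupData.gl n K).Adelic :=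
  GLn.ofInfinite n K

/-- `GLn.ofInfiniteAdelic` is continuous. [folklore] -/
theorem GLn.continuous_ofInfiniteAdelic : Continuous (GLn.ofInfiniteAdelic n K) :=
  GLn.continuous_ofInfinite n K

/-- The action of `GL_n(K_∞)` on the automorphic quotient `GL_n(𝔸_K) ⧸ A_G GL_n(K)` through the
embedding `x ↦ (x, 1)` (`GLn.ofInfiniteAdelic`; a *local* instance below). [folklore] -/
@[reducible] def glInfAction :
    MulAction (GL (Fin n) (mixedSpace K)) (AdelicGroupData.gl n K).automorphicQuotient :=
  MulAction.compHom _ (GLn.ofInfiniteAdelic n K)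

attribute [local instance] glInfAction

/-- The action of `GL_n(K_∞)` on the automorphic quotient is jointly continuous. [folklore] -/
theorem continuousSMul_glInf :
    ContinuousSMul (GL (Fin n) (mixedSpace K)) (AdelicGroupData.gl n K).automorphicQuotient :=
  ⟨(continuous_smul.comp ((GLn.continuous_ofInfiniteAdelic n K).prodMap continuous_id) :
    Continuous fun p : GL (Fin n) (mixedSpace K) × (AdelicGroupData.gl n K).automorphicQuotient =>
      GLn.ofInfiniteAdelic n K p.1 • p.2)⟩

variable {n K} in
/-- An invariant measure on the automorphic quotient is invariant under `GL_n(K_∞)`. [folklore] -/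
theorem smulInvariantMeasure_glInf (μ : Measure (AdelicGroupData.gl n K).automorphicQuotient)
    [SMulInvariantMeasure (AdelicGroupData.gl n K).Adelic (AdelicGroupData.gl n K).automorphicQuotient μ] :
    SMulInvariantMeasure (GL (Fin n) (mixedSpace K)) (AdelicGroupData.gl n K).automorphicQuotient μ :=
  ⟨fun x _ hs => SMulInvariantMeasure.measure_preimage_smul (μ := μ) (GLn.ofInfiniteAdelic n K x) hs⟩

end Action

/-! ### The `L²` side from the convolution identity -/

section L2

variable {n : ℕ} {K : Type} [Field K] [NumberField K]
  {hcpt : isCompact_glFiniteIntegralLevel n K}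
  {μ : Measure (AdelicGroupData.gl n K).automorphicQuotient}
  [(AdelicGroupData.gl n K).IsAutomorphicMeasure μ]

attribute [local instance] glInfBorel borelSpace_glInf locallyCompactSpace_glInf
  secondCountableTopology_glInf glInfAction continuousSMul_glInf smulInvariantMeasure_glInf

-- Mathlib idiom (Mathlib/Algebra/Lie/OfAssociative.lean); needed to mention Lie subalgebras of matrix algebras
attribute [local instance 100] LieRing.ofAssociativeRing

/-- **The domain action of `(x, 1)` on `L²` is the regular representation at `(x, 1)`**: for
`x ∈ GL_n(K_∞)` and `v ∈ L²(μ)`, `xᵈᵐᵃ⁻¹ • v = R((x, 1)) v` (both are represented by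
`x₀ ↦ v((x, 1)⁻¹ • x₀)`). [folklore] -/
theorem domSMul_ofInfinite_eq_rightRegular (x : GL (Fin n) (mixedSpace K))
    (v : (AdelicGroupData.gl n K).L2 μ) :
    (DomMulAct.mk x⁻¹ • v : (AdelicGroupData.gl n K).L2 μ) =
      (AdelicGroupData.gl n K).rightRegular μ (GLn.ofInfiniteAdelic n K x) v := by
  refine Lp.ext ?_
  refine (DomMulAct.smul_Lp_ae_eq (DomMulAct.mk x⁻¹) v).trans ?_
  refine Filter.EventuallyEq.trans ?_ (AdelicGroupData.rightRegular_apply_coeFn _ _ _ _).symm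
  refine Eventually.of_forall fun x₀ => ?_
  simp only [Equiv.symm_apply_apply]
  change v (GLn.ofInfiniteAdelic n K x⁻¹ • x₀) = v ((GLn.ofInfiniteAdelic n K x)⁻¹ • x₀)
  rw [map_inv]

variable (hcpt μ) in
/-- **The `L²` side of Borel–Jacquet 4.6 for `GL_n` from the convolution identity** (discharge of
the statement of `AutomorphicRepsGL.exists_toLp_mem_invQuot_eq_lieDeriv hcpt μ` from
`AutomorphicRepsGL.exists_convolution_eq_self hcpt`). Let `Π ≤ L²(μ)` be closed and invariant,
`f ∈ ℒ²(μ)` with `[f] ∈ Π` and `φ = invQuot f` automorphic, `X ∈ 𝔤𝔩_n(K_∞)`. With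
`X φ = φ ∗ α_X` (`exists_weight_lieDeriv_eq_integral`): the Bochner integral
`v_X = ∫ α_X(x) Π(x, 1) [f] dν(x)` lies in the closed subspace `Π`, and is represented by
`f_X = (x₀ ↦ ∫ α_X(x) f((x, 1)⁻¹ • x₀) dν)` (`coeFn_integral_smul_domSMul_ae_eq`), whose
`invQuot` is `g ↦ ∫ α_X(x) φ(g x) dν = (X φ)(g)`. Borel 1972, 3.8 and Cor. 3.20–3.21;
Borel–Jacquet 1979, 4.6. [cite: BorelJacquet1979, 4.6] -/
theorem exists_toLp_mem_invQuot_eq_lieDeriv_of_convolution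
    (hHC : AutomorphicRepsGL.exists_convolution_eq_self hcpt)
    (P : ContRepresentation.ClosedSubrep ((AdelicGroupData.gl n K).rightRegular μ))
    (f : (AdelicGroupData.gl n K).automorphicQuotient → ℂ) (hf : MemLp f 2 μ) (hfP : hf.toLp f ∈ P)
    (hφ : IsAutomorphicForm (AutomorphyDatum.gl n K hcpt) (invQuot (AdelicGroupData.gl n K) f))
    (X : (AutomorphyDatum.gl n K hcpt).arch.lie) :
    ∃ (f' : (AdelicGroupData.gl n K).automorphicQuotient → ℂ) (hf' : MemLp f' 2 μ),
      hf'.toLp f' ∈ P ∧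
        invQuot (AdelicGroupData.gl n K) f' =
          lieDeriv (AutomorphyDatum.gl n K hcpt).ofArch X (invQuot (AdelicGroupData.gl n K) f) := by
  set ν : Measure (GL (Fin n) (mixedSpace K)) := Measure.haar with hν
  set φ := invQuot (AdelicGroupData.gl n K) f with hφ_def
  obtain ⟨αX, hαXc, hαXs, hint⟩ := exists_weight_lieDeriv_eq_integral hHC ν hφ X
  set v : (AdelicGroupData.gl n K).L2 μ := hf.toLp f with hv
  -- strong continuity of `x ↦ R(x, 1) v`
  have hRc : Continuous fun x : GL (Fin n) (mixedSpace K) =>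
      (AdelicGroupData.gl n K).rightRegular μ (GLn.ofInfiniteAdelic n K x) v :=
    ((AdelicGroupData.isStronglyContinuous_rightRegular_holds (AdelicGroupData.gl n K) μ) v).comp
      (GLn.continuous_ofInfiniteAdelic n K)
  have hdomc : Continuous fun x : GL (Fin n) (mixedSpace K) =>
      (DomMulAct.mk x⁻¹ • v : (AdelicGroupData.gl n K).L2 μ) := by
    simp only [domSMul_ofInfinite_eq_rightRegular]
    exact hRc
  -- the vector `v_X = ∫ α_X(x) Π(x, 1) [f] dν(x)`, computed in the complete subspace `Π`
  set vP : P.toSubmodule := ⟨v, hfP⟩ with hvP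
  have hPc : Continuous fun x : GL (Fin n) (mixedSpace K) => P.toContRep (GLn.ofInfiniteAdelic n K x) vP :=
    (continuous_toContRep_apply P vP).comp (GLn.continuous_ofInfiniteAdelic n K)
  have hPi : Integrable (fun x : GL (Fin n) (mixedSpace K) =>
      (αX x) • P.toContRep (GLn.ofInfiniteAdelic n K x) vP) ν :=
    (hαXc.smul hPc).integrable_of_hasCompactSupport hαXs.smul_right
  set wP : P.toSubmodule := ∫ x, (αX x) • P.toContRep (GLn.ofInfiniteAdelic n K x) vP ∂ν with hwP
  have hwcoe : (wP : (AdelicGroupData.gl n K).L2 μ) =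
      ∫ x, (αX x) • (DomMulAct.mk x⁻¹ • v : (AdelicGroupData.gl n K).L2 μ) ∂ν := by
    rw [hwP, ← Submodule.subtypeL_apply, ← ContinuousLinearMap.integral_comp_comm _ hPi]
    congr 1 with x
  -- it is represented by the orbital smoothing of `f`
  have hw_ae : ((wP : (AdelicGroupData.gl n K).L2 μ) : (AdelicGroupData.gl n K).automorphicQuotient → ℂ)
      =ᵐ[μ] orbitalSmoothing ν αX f := by
    rw [hwcoe]
    refine (coeFn_integral_smul_domSMul_ae_eq μ ν hαXc hαXs v hdomc.aestronglyMeasurable).trans ?_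
    exact orbitalSmoothing_ae_eq_of_ae_eq μ ν αX (MemLp.coeFn_toLp hf)
  -- the orbital smoothing of `f`, read through `invQuot`, is `X φ`
  set fX : (AdelicGroupData.gl n K).automorphicQuotient → ℂ := orbitalSmoothing ν αX f with hfX_def
  have hfXinv : invQuot (AdelicGroupData.gl n K) fX =
      lieDeriv (AutomorphyDatum.gl n K hcpt).ofArch X φ := by
    funext g
    rw [invQuot_apply, hint g, hfX_def]
    unfold orbitalSmoothing
    congr 1 with x
    -- `α_X(x) f ((x, 1)⁻¹ • [g⁻¹]) = φ (g (x, 1)) α_X(x)` (definitionally, up to the order of factors)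
    rw [smul_eq_mul, mul_comm]
    congr 1
  -- `f_X ∈ ℒ²(μ)` with class `v_X ∈ Π`
  have hfXmem : MemLp fX 2 μ := (Lp.memLp (wP : (AdelicGroupData.gl n K).L2 μ)).ae_eq hw_ae
  have htoLp : hfXmem.toLp fX = (wP : (AdelicGroupData.gl n K).L2 μ) :=
    Lp.ext ((MemLp.coeFn_toLp hfXmem).trans hw_ae.symm)
  refine ⟨fX, hfXmem, ?_, hfXinv⟩
  rw [htoLp]
  exact wP.2

end L2

end Literature.NumberTheory.Automorphic
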